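import Literature.Geometry.Riemannian.MCFEntropyMonotonicity
import Literature.Geometry.Riemannian.ColdingMinicozziEntropyDensity
import HarnessLib

/-!
# The Gaussian density of a classical mean curvature flow at a regular point is `1`

Topic `Literature/Geometry/Riemannian`. For a classical mean curvature flow `(F, ν)` of a compact
`n`-manifold in `ℝⁿ⁺¹` on `[a, b]` (`IsClassicalMCF`), a time `T ∈ (a, b]` and a point
`x₀ = F_T(w₀)` of the smooth embedded slice `M_T`, Huisken's Gaussian density
`Θ(x₀, T) = lim_{t↑T} F_{x₀,T-t}(M_t)` — which exists and is the infimum by the monotonicity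
formula (`IsClassicalMCF.tendsto_gaussianArea_image`, `MCFEntropyMonotonicity.lean`) — is equal to
`1`:

* `IsClassicalMCF.gaussianDensity_eq_one` — `Θ(F_T(w₀), T) = 1`;
* `IsClassicalMCF.tendsto_gaussianArea_image_regular` — `F_{F_T(w₀),T-t}(M_t) → 1` as `t ↑ T`;
* `IsClassicalMCF.gaussianDensity_eq_zero_of_notMem`, `IsClassicalMCF.tendsto_gaussianArea_image_of_notMem`
  — off the slice (`x₀ ∉ M_T`) the density is `0`: `F_{x₀,T-t}(M_t) → 0`.

(The deep converse — density close to `1` forces regularity — is White's / Brakke's local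
regularity theorem, not attempted here.)

Proof. Against the fixed area measure `μ_T`: `F_{x₀,τ}(M_{T-τ}) = ∫_N ρ_τ(F_{T-τ}) θ_{T-τ} dμ_T`
(`gaussianArea_image_eq`, `gaussianIntegral_eq_integral`) with the density ratio
`1 ≤ θ_{T-τ} ≤ 1 + Kτ` (`θ` is non-increasing with `|∂ₜθ| = H²θ` bounded) and the displacement
`‖F_{T-τ} - F_T‖ ≤ C'τ` (velocity bound); the Peter–Paul weight comparisons
`e^{-‖y+d‖²/4τ} ≤ e^{(1/η-1)‖d‖²/4τ} e^{-(1-η)‖y‖²/4τ}`,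
`e^{-‖y+d‖²/4τ} ≥ e^{-(1+1/η)‖d‖²/4τ} e^{-(1+η)‖y‖²/4τ}` (`exp_neg_norm_add_sq_le`,
`le_exp_neg_norm_add_sq`) squeeze the integral between `(1±η)^{-n/2}(1+o(1)) F_{x₀,τ/(1±η)}(M_T)`,
and `F_{x₀,τ'}(M_T) → 1` as `τ' → 0⁺` is Colding–Minicozzi's Lemma 7.2 (3) for the smooth embedded
slice (`tendsto_gaussianArea_range_nhdsGT_zero`, `ColdingMinicozziEntropyDensity.lean`); finally
`η → 0`. Everything is PROVED; no definitions, no named facts.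

## References

* G. Huisken, J. Differential Geom. 31 (1990), Thm. 3.1 and §3 (Gaussian density). [Huisken1990]
* T. H. Colding, W. P. Minicozzi II, Ann. of Math. 175 (2012), Lemma 7.2 (3). [ColdingMinicozzi2012]
* B. White, *A local regularity theorem for mean curvature flow*, Ann. of Math. 161 (2005)
  (the converse; cited for context only).
-/

noncomputable section

open Bundle Set Function Filter MeasureTheory Module Metric
open scoped Manifold ContDiff Topology RealInnerProductSpace ENNReal

namespace Literature.Geometry.Riemannian

open Lorentzian Lorentzian.PseudoRiemannianMetric EuclideanHypersurface

section WeightComparison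

variable {V : Type*} [NormedAddCommGroup V] [InnerProductSpace ℝ V]

/-- Peter–Paul: `-(η‖y‖² + ‖d‖²/η) ≤ 2⟪y, d⟫ ≤ η‖y‖² + ‖d‖²/η` for `η > 0`. [folklore] -/
theorem abs_two_inner_le_peterPaul (y d : V) {η : ℝ} (hη : 0 < η) :
    -(η * ‖y‖ ^ 2 + ‖d‖ ^ 2 / η) ≤ 2 * ⟪y, d⟫ ∧ 2 * ⟪y, d⟫ ≤ η * ‖y‖ ^ 2 + ‖d‖ ^ 2 / η := by
  have h0 : 0 ≤ ‖η • y + d‖ ^ 2 := sq_nonneg _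
  have h0' : 0 ≤ ‖η • y - d‖ ^ 2 := sq_nonneg _
  rw [norm_add_sq_real, norm_smul, mul_pow, Real.norm_eq_abs, sq_abs, real_inner_smul_left] at h0
  rw [norm_sub_sq_real, norm_smul, mul_pow, Real.norm_eq_abs, sq_abs, real_inner_smul_left] at h0'
  have h4 : η * ‖y‖ ^ 2 + 2 * ⟪y, d⟫ + ‖d‖ ^ 2 / η =
      (η ^ 2 * ‖y‖ ^ 2 + 2 * (η * ⟪y, d⟫) + ‖d‖ ^ 2) / η := by
    field_simp
  have h4' : η * ‖y‖ ^ 2 - 2 * ⟪y, d⟫ + ‖d‖ ^ 2 / η =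
      (η ^ 2 * ‖y‖ ^ 2 - 2 * (η * ⟪y, d⟫) + ‖d‖ ^ 2) / η := by
    field_simp
  have h5 : 0 ≤ (η ^ 2 * ‖y‖ ^ 2 + 2 * (η * ⟪y, d⟫) + ‖d‖ ^ 2) / η := div_nonneg h0 hη.le
  have h5' : 0 ≤ (η ^ 2 * ‖y‖ ^ 2 - 2 * (η * ⟪y, d⟫) + ‖d‖ ^ 2) / η := div_nonneg h0' hη.le
  constructor <;> linarith

/-- **Upper Gaussian weight comparison**: for `τ > 0`, `0 < η < 1`,
`e^{-‖y+d‖²/4τ} ≤ e^{(1/η - 1)‖d‖²/4τ} · e^{-(1-η)‖y‖²/4τ}` (from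
`‖y + d‖² ≥ (1-η)‖y‖² - (1/η - 1)‖d‖²`). [folklore] -/
theorem exp_neg_norm_add_sq_le (y d : V) {τ η : ℝ} (hτ : 0 < τ) (hη : 0 < η) :
    Real.exp (-‖y + d‖ ^ 2 / (4 * τ)) ≤
      Real.exp ((1 / η - 1) * ‖d‖ ^ 2 / (4 * τ)) * Real.exp (-((1 - η) * ‖y‖ ^ 2) / (4 * τ)) := by
  rw [← Real.exp_add]
  refine Real.exp_le_exp.2 ?_
  have hpp := (abs_two_inner_le_peterPaul y d hη).1
  have hsq : ‖y + d‖ ^ 2 = ‖y‖ ^ 2 + 2 * ⟪y, d⟫ + ‖d‖ ^ 2 := norm_add_sq_real y d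
  have hkey : (1 - η) * ‖y‖ ^ 2 - (1 / η - 1) * ‖d‖ ^ 2 ≤ ‖y + d‖ ^ 2 := by
    rw [hsq, show (1 / η - 1) * ‖d‖ ^ 2 = ‖d‖ ^ 2 / η - ‖d‖ ^ 2 by ring]
    linarith
  have h4 : (0 : ℝ) < 4 * τ := by positivity
  rw [← add_div, div_le_div_iff_of_pos_right h4]
  linarith

/-- **Lower Gaussian weight comparison**: for `τ > 0`, `η > 0`,
`e^{-(1 + 1/η)‖d‖²/4τ} · e^{-(1+η)‖y‖²/4τ} ≤ e^{-‖y+d‖²/4τ}` (from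
`‖y + d‖² ≤ (1+η)‖y‖² + (1 + 1/η)‖d‖²`). [folklore] -/
theorem le_exp_neg_norm_add_sq (y d : V) {τ η : ℝ} (hτ : 0 < τ) (hη : 0 < η) :
    Real.exp (-((1 + 1 / η) * ‖d‖ ^ 2) / (4 * τ)) * Real.exp (-((1 + η) * ‖y‖ ^ 2) / (4 * τ)) ≤
      Real.exp (-‖y + d‖ ^ 2 / (4 * τ)) := by
  rw [← Real.exp_add]
  refine Real.exp_le_exp.2 ?_
  have hpp := (abs_two_inner_le_peterPaul y d hη).2
  have hsq : ‖y + d‖ ^ 2 = ‖y‖ ^ 2 + 2 * ⟪y, d⟫ + ‖d‖ ^ 2 := norm_add_sq_real y d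
  have hkey : ‖y + d‖ ^ 2 ≤ (1 + η) * ‖y‖ ^ 2 + (1 + 1 / η) * ‖d‖ ^ 2 := by
    rw [hsq, show (1 + 1 / η) * ‖d‖ ^ 2 = ‖d‖ ^ 2 + ‖d‖ ^ 2 / η by ring]
    linarith
  have h4 : (0 : ℝ) < 4 * τ := by positivity
  rw [← add_div, div_le_div_iff_of_pos_right h4]
  linarith

/-- Rescaling the Gaussian normalisation: `(4πτ)^{-n/2} = s^{-n/2} · (4π(τ/s))^{-n/2}`? No — we use
`(4πτ)^{-n/2} = s^{-(n/2)} (4π (τ/s))^{-n/2}` in the form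
`(4πτ)^{-n/2} = (4π(τ/s))^{-n/2} * s ^ (-(n:ℝ)/2)` for `s, τ > 0`. [folklore] -/
theorem gaussNormalization_rescale (n : ℕ) {τ s : ℝ} (hτ : 0 < τ) (hs : 0 < s) :
    (4 * Real.pi * τ) ^ (-(n : ℝ) / 2) =
      (4 * Real.pi * (τ / s)) ^ (-(n : ℝ) / 2) * s ^ (-(n : ℝ) / 2) := by
  rw [show 4 * Real.pi * (τ / s) = (4 * Real.pi * τ) / s by ring,
    Real.div_rpow (by positivity) hs.le, div_mul_cancel₀]
  exact (Real.rpow_pos_of_pos hs _).ne'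

end WeightComparison


section RegularPoint

variable {n : ℕ} {N : Type*} [TopologicalSpace N] [ChartedSpace (EuclideanSpace ℝ (Fin n)) N]
  [IsManifold (𝓡 n) ∞ N] [CompactSpace N] [T2Space N] [MeasurableSpace N] [BorelSpace N]
  {F : ℝ → N → EuclideanSpace ℝ (Fin (n + 1))}
  {ν : (t : ℝ) → NormalField (𝓡 (n + 1)) (F t)} {a b : ℝ}

/-- **The Gaussian density of a classical mean curvature flow at a regular point is `1`.**
For a classical mean curvature flow on `[a, b]`, a time `T ∈ (a, b]` and a point `x₀ = F_T(w₀)` of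
the (smooth, embedded) time-`T` slice, Huisken's Gaussian density
`Θ(x₀, T) = lim_{t↑T} F_{x₀,T-t}(M_t)` (which exists and is the infimum,
`IsClassicalMCF.tendsto_gaussianArea_image`) equals `1`. Proof: against the fixed measure `μ_T`,
`F_{x₀,τ}(M_{T-τ}) = ∫ ρ_τ(F_{T-τ}) θ_{T-τ} dμ_T` with `1 ≤ θ_{T-τ} ≤ 1 + Kτ` and
`‖F_{T-τ} - F_T‖ ≤ C'τ ≪ √τ`; the Peter–Paul comparisons
`e^{-‖y+d‖²/4τ} ≶ e^{±c‖d‖²/4τ} e^{-(1∓η)‖y‖²/4τ}` squeeze it between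
`(1±η)^{-n/2} (1 + o(1)) F_{x₀,τ/(1±η)}(M_T)`, and `F_{x₀,τ'}(M_T) → 1`
(`tendsto_gaussianArea_range_nhdsGT_zero`, `ColdingMinicozziEntropyDensity.lean`); finally `η → 0`.
(White's local regularity theorem is the deep converse.) [cite: Huisken1990, Thm. 3.1]
[cite: ColdingMinicozzi2012, Lemma 7.2 (3)] -/
theorem IsClassicalMCF.gaussianDensity_eq_one
    (h : IsClassicalMCF (euclideanMetric (EuclideanSpace ℝ (Fin (n + 1)))) F ν a b) {T : ℝ}
    (hT : T ∈ Ioc a b) (w₀ : N) :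
    sInf ((fun t ↦ gaussianArea n (F T w₀) (T - t) (F t '' univ)) '' Ioo a T) = 1 := by
  obtain ⟨U, hU, hIU, hF⟩ := h.contMDiffOn
  have hT' : T ∈ Icc a b := ⟨hT.1.le, hT.2⟩
  set x₀ : EuclideanSpace ℝ (Fin (n + 1)) := F T w₀ with hx₀
  -- ### the limit `Θ`
  set Θ := sInf ((fun t ↦ gaussianArea n x₀ (T - t) (F t '' univ)) '' Ioo a T) with hΘ
  have hlim : Tendsto (fun t ↦ gaussianArea n x₀ (T - t) (F t '' univ)) (𝓝[<] T) (𝓝 Θ) :=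
    h.tendsto_gaussianArea_image x₀ hT
  -- ### velocity bound and displacement
  have hK : IsCompact (Icc a b ×ˢ (univ : Set N)) := isCompact_Icc.prod isCompact_univ
  obtain ⟨C', hC'⟩ := hK.exists_bound_of_continuousOn
    ((continuousOn_timeDeriv hU hF).mono (Set.prod_mono hIU subset_rfl))
  have hC'0 : 0 ≤ C' := (norm_nonneg _).trans (hC' (T, w₀) ⟨hT', mem_univ _⟩)
  have hvel : ∀ t ∈ Icc a b, ∀ w, ‖deriv (fun s ↦ F s w) t‖ ≤ C' := fun t ht w ↦
    hC' (t, w) ⟨ht, mem_univ _⟩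
  have hdisp : ∀ t ∈ Icc a b, ∀ w, ‖F t w - F T w‖ ≤ C' * (T - t) ∨ T < t := by
    intro t ht w
    by_cases htT : t ≤ T
    · left
      have hmv := (convex_Icc a b).norm_image_sub_le_of_norm_hasDerivWithin_le
        (f := fun s ↦ F s w) (fun s hs ↦ (hasDerivAt_slice hU hF (hIU hs) w).hasDerivWithinAt)
        (fun s hs ↦ hvel s hs w) hT' ht
      rw [Real.norm_eq_abs, abs_of_nonpos (by linarith), neg_sub] at hmv
      exact hmv
    · right; exact not_le.1 htT
  -- ### the densities relative to `μ_T`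
  set μT := riemannianMeasure ((euclideanMetric (EuclideanSpace ℝ (Fin (n + 1)))).inducedRiemannianMetric
    (F T) contMDiff_pullbackBilin_holds (h.isSpacelikeImmersion T hT')) with hμT
  haveI : IsFiniteMeasure μT := isFiniteMeasure_riemannianMeasure _
  set g : ∀ t, t ∈ Icc a b → ContMDiffRiemannianMetric (𝓡 n) ∞ (EuclideanSpace ℝ (Fin n))
      (TangentSpace (𝓡 n) : N → Type _) := fun t ht ↦
    (euclideanMetric (EuclideanSpace ℝ (Fin (n + 1)))).inducedRiemannianMetric (F t)
      contMDiff_pullbackBilin_holds (h.isSpacelikeImmersion t ht) with hg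
  set D : ℝ → N → ℝ := fun t w ↦ (Matrix.of fun i j ↦
    (euclideanMetric (EuclideanSpace ℝ (Fin (n + 1)))).inducedBilin (𝓡 n) (F t) w
      ((trivializationAt (EuclideanSpace ℝ (Fin n)) (TangentSpace (𝓡 n)) w).localFrame
        (EuclideanSpace.basisFun (Fin n) ℝ).toBasis i w)
      ((trivializationAt (EuclideanSpace ℝ (Fin n)) (TangentSpace (𝓡 n)) w).localFrame
        (EuclideanSpace.basisFun (Fin n) ℝ).toBasis j w)).det with hD
  set θ : ℝ → N → ℝ := fun t w ↦ Real.sqrt (D t w) / Real.sqrt (D T w) with hθ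
  have hDchart : ∀ t (ht : t ∈ Icc a b) w,
      chartGramMatrix (g t ht) w (extChartAt (𝓡 n) w w) = Matrix.of fun i j ↦
        (euclideanMetric (EuclideanSpace ℝ (Fin (n + 1)))).inducedBilin (𝓡 n) (F t) w
          ((trivializationAt (EuclideanSpace ℝ (Fin n)) (TangentSpace (𝓡 n)) w).localFrame
            (EuclideanSpace.basisFun (Fin n) ℝ).toBasis i w)
          ((trivializationAt (EuclideanSpace ℝ (Fin n)) (TangentSpace (𝓡 n)) w).localFrame
            (EuclideanSpace.basisFun (Fin n) ℝ).toBasis j w) :=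
    fun t ht w ↦ chartGramMatrix_inducedRiemannianMetric_self (h.isSpacelikeImmersion t ht) w
  have hDpos : ∀ t (ht : t ∈ Icc a b) w, 0 < Real.sqrt (D t w) := fun t ht w ↦ by
    have := sqrt_det_chartGramMatrix_pos (g t ht) w (mem_extChartAt_target w)
    rwa [hDchart t ht w] at this
  have hθcan : ∀ t (ht : t ∈ Icc a b), θ t = fun w ↦
      Real.sqrt (chartGramMatrix (g t ht) w (extChartAt (𝓡 n) w w)).det /
        Real.sqrt (chartGramMatrix (g T hT') w (extChartAt (𝓡 n) w w)).det := fun t ht ↦ by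
    funext w
    simp only [hθ, hD, hDchart t ht w, hDchart T hT' w]
  have hθcont : ∀ t (ht : t ∈ Icc a b), Continuous (θ t) := fun t ht ↦ by
    rw [hθcan t ht]
    exact continuous_sqrt_det_chartGramMatrix_div (g t ht) (g T hT')
  have hθpos : ∀ t (ht : t ∈ Icc a b) w, 0 < θ t w := fun t ht w ↦
    div_pos (hDpos t ht w) (hDpos T hT' w)
  have hθT : ∀ w, θ T w = 1 := fun w ↦ div_self (hDpos T hT' w).ne'
  have hθd : ∀ t (ht : t ∈ Icc a b) w, HasDerivAt (fun s ↦ θ s w)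
      (-‖deriv (fun s ↦ F s w) t‖ ^ 2 * θ t w) t := fun t ht w ↦ by
    have hd := (h.hasDerivAt_sqrt_det_gram_localFrame ht w).div_const (Real.sqrt (D T w))
    simp only [hθ]
    refine hd.congr_deriv ?_
    rw [h.norm_deriv_sq_eq ht w]
    simp only [hD]
    ring
  have ha : a ∈ Icc a b := ⟨le_rfl, hT'.1.trans hT'.2⟩
  obtain ⟨Mθ, hMθ⟩ := (isCompact_univ (X := N)).exists_bound_of_continuousOn (hθcont a ha).continuousOn
  have hθanti : ∀ w, AntitoneOn (fun s ↦ θ s w) (Icc a b) := fun w ↦ by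
    refine antitoneOn_of_hasDerivWithinAt_nonpos (convex_Icc a b)
      (f' := fun t ↦ -‖deriv (fun s ↦ F s w) t‖ ^ 2 * θ t w)
      (fun t ht ↦ (hθd t ht w).continuousAt.continuousWithinAt)
      (fun t ht ↦ (hθd t (interior_subset ht) w).hasDerivWithinAt) fun t ht ↦ ?_
    have := hθpos t (interior_subset ht) w
    nlinarith [sq_nonneg ‖deriv (fun s ↦ F s w) t‖]
  have hθle : ∀ t ∈ Icc a b, ∀ w, θ t w ≤ Mθ := fun t ht w ↦ by
    have h1 : θ t w ≤ θ a w := hθanti w ha ht ht.1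
    have h2 : θ a w ≤ Mθ := by
      have := hMθ w (mem_univ w)
      rw [Real.norm_eq_abs] at this
      exact (le_abs_self _).trans this
    exact h1.trans h2
  have hMθ0 : 0 ≤ Mθ := (hθpos a ha w₀).le.trans (hθle a ha w₀)
  -- `1 ≤ θ_t ≤ 1 + K (T - t)` for `t ≤ T`
  set K : ℝ := C' ^ 2 * Mθ with hKdef
  have hθge : ∀ t ∈ Icc a b, t ≤ T → ∀ w, 1 ≤ θ t w := fun t ht htT w ↦ by
    rw [← hθT w]; exact hθanti w ht hT' htT
  have hθup : ∀ t ∈ Icc a b, t ≤ T → ∀ w, θ t w ≤ 1 + K * (T - t) := fun t ht htT w ↦ by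
    have hmv := (convex_Icc a b).norm_image_sub_le_of_norm_hasDerivWithin_le (C := K)
      (f := fun s ↦ θ s w) (fun s hs ↦ (hθd s hs w).hasDerivWithinAt) (fun s hs ↦ ?_) hT' ht
    · rw [Real.norm_eq_abs, Real.norm_eq_abs, abs_of_nonpos (by linarith : t - T ≤ 0), neg_sub, hθT w] at hmv
      linarith [le_abs_self (θ t w - 1)]
    · rw [Real.norm_eq_abs, abs_mul, abs_neg, abs_of_nonneg (sq_nonneg _), abs_of_nonneg (hθpos s hs w).le]
      exact mul_le_mul (pow_le_pow_left₀ (norm_nonneg _) (hvel s hs w) 2) (hθle s hs w) (hθpos s hs w).le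
        (by positivity)
  -- freeze
  clear_value θ D
  -- ### the two integrals
  -- `J t = ∫ ρ_{T-t}(F_t) θ_t dμ_T` (`= F_{x₀,T-t}(M_t)`), `S τ = ∫ ρ_τ(F_T) dμ_T` (`= F_{x₀,τ}(M_T)`)
  have hJ : ∀ t ∈ Ioo a T, gaussianArea n x₀ (T - t) (F t '' univ) =
      ENNReal.ofReal (∫ w, ((4 * Real.pi * (T - t)) ^ (-(n : ℝ) / 2) *
        Real.exp (-‖F t w - x₀‖ ^ 2 / (4 * (T - t)))) * θ t w ∂μT) := by
    intro t ht
    have htb : t ∈ Icc a b := ⟨ht.1.le, (ht.2.le.trans hT.2)⟩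
    have e1 := h.gaussianArea_image_eq htb x₀ (sub_pos.2 ht.2)
    have e := h.gaussianIntegral_eq_integral htb hT' x₀ T
    rw [e1]
    refine congrArg ENNReal.ofReal ?_
    simp only [hθ, hD]
    exact e.symm
  have hS : ∀ {τ : ℝ}, 0 < τ → gaussianArea n x₀ τ (F T '' univ) =
      ENNReal.ofReal (∫ w, (4 * Real.pi * τ) ^ (-(n : ℝ) / 2) *
        Real.exp (-‖F T w - x₀‖ ^ 2 / (4 * τ)) ∂μT) := fun {τ} hτ ↦
    h.gaussianArea_image_eq hT' x₀ hτ
  have hSnn : ∀ τ : ℝ, 0 < τ → 0 ≤ ∫ w, (4 * Real.pi * τ) ^ (-(n : ℝ) / 2) *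
      Real.exp (-‖F T w - x₀‖ ^ 2 / (4 * τ)) ∂μT := fun τ hτ ↦
    integral_nonneg fun w ↦ mul_nonneg (Real.rpow_nonneg (by positivity) _) (Real.exp_pos _).le
  -- the static density: `S τ → 1`
  have hFT : ContMDiff (𝓡 n) 𝓘(ℝ, EuclideanSpace ℝ (Fin (n + 1))) ∞ (F T) :=
    (h.isSpacelikeImmersion T hT').contMDiff
  have hstatic : Tendsto (fun τ : ℝ ↦ gaussianArea n x₀ τ (range (F T))) (𝓝[>] 0) (𝓝 1) :=
    tendsto_gaussianArea_range_nhdsGT_zero (I := 𝓡 n) (finrank_euclideanSpace_fin (𝕜 := ℝ) (n := n))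
      hFT (by simp) (h.injective T hT') w₀
      ((h.isSpacelikeImmersion T hT').injective_mfderiv w₀)
  have hSlim : Tendsto (fun τ : ℝ ↦ ∫ w, (4 * Real.pi * τ) ^ (-(n : ℝ) / 2) *
      Real.exp (-‖F T w - x₀‖ ^ 2 / (4 * τ)) ∂μT) (𝓝[>] 0) (𝓝 1) := by
    have h1 := (ENNReal.tendsto_toReal ENNReal.one_ne_top).comp hstatic
    rw [ENNReal.toReal_one] at h1
    refine h1.congr' ?_
    filter_upwards [self_mem_nhdsWithin] with τ hτ
    rw [mem_Ioi] at hτ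
    rw [comp_apply, ← image_univ, hS hτ, ENNReal.toReal_ofReal (hSnn τ hτ)]
  -- ### continuity of the integrands in `w`
  have hFc : ∀ t ∈ Icc a b, Continuous (F t) := fun t ht ↦ (h.isSpacelikeImmersion t ht).contMDiff.continuous
  have hEc : ∀ t ∈ Icc a b, ∀ τ : ℝ, Continuous fun w ↦ Real.exp (-‖F t w - x₀‖ ^ 2 / (4 * τ)) :=
    fun t ht τ ↦ ((((hFc t ht).sub continuous_const).norm.pow 2).neg.div_const _).rexp
  -- ### the squeeze for fixed `η ∈ (0, 1)`
  have hsqueeze : ∀ η : ℝ, 0 < η → η < 1 →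
      ENNReal.ofReal ((1 + η) ^ (-(n : ℝ) / 2)) ≤ Θ ∧ Θ ≤ ENNReal.ofReal ((1 - η) ^ (-(n : ℝ) / 2)) := by
    intro η hη hη1
    have h1η : 0 < 1 - η := by linarith
    have h1η' : 0 < 1 + η := by linarith
    -- pointwise bounds, then integrated bounds, for `t ∈ Ioo a T`
    have hbounds : ∀ t ∈ Ioo a T,
        (∫ w, ((4 * Real.pi * (T - t)) ^ (-(n : ℝ) / 2) *
          Real.exp (-‖F t w - x₀‖ ^ 2 / (4 * (T - t)))) * θ t w ∂μT) ≤
          (Real.exp ((1 / η - 1) * C' ^ 2 * (T - t) / 4) * (1 + K * (T - t)) *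
            (1 - η) ^ (-(n : ℝ) / 2)) *
          ∫ w, (4 * Real.pi * ((T - t) / (1 - η))) ^ (-(n : ℝ) / 2) *
            Real.exp (-‖F T w - x₀‖ ^ 2 / (4 * ((T - t) / (1 - η)))) ∂μT ∧
        (Real.exp (-((1 + 1 / η) * C' ^ 2 * (T - t)) / 4) * (1 + η) ^ (-(n : ℝ) / 2)) *
          ∫ w, (4 * Real.pi * ((T - t) / (1 + η))) ^ (-(n : ℝ) / 2) *
            Real.exp (-‖F T w - x₀‖ ^ 2 / (4 * ((T - t) / (1 + η)))) ∂μT ≤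
        ∫ w, ((4 * Real.pi * (T - t)) ^ (-(n : ℝ) / 2) *
          Real.exp (-‖F t w - x₀‖ ^ 2 / (4 * (T - t)))) * θ t w ∂μT := by
      intro t ht
      have hτ : 0 < T - t := sub_pos.2 ht.2
      have htb : t ∈ Icc a b := ⟨ht.1.le, ht.2.le.trans hT.2⟩
      set τ := T - t with hτdef
      have hd : ∀ w, ‖F t w - F T w‖ ≤ C' * τ := fun w ↦
        (hdisp t htb w).resolve_right (not_lt.2 ht.2.le)
      have hd2 : ∀ w, ‖F t w - F T w‖ ^ 2 ≤ C' ^ 2 * τ ^ 2 := fun w ↦ by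
        have := hd w
        nlinarith [norm_nonneg (F t w - F T w)]
      have hresc1 := gaussNormalization_rescale n hτ h1η
      have hresc2 := gaussNormalization_rescale n hτ h1η'
      -- pointwise
      have hup : ∀ w, ((4 * Real.pi * τ) ^ (-(n : ℝ) / 2) *
          Real.exp (-‖F t w - x₀‖ ^ 2 / (4 * τ))) * θ t w ≤
          (Real.exp ((1 / η - 1) * C' ^ 2 * τ / 4) * (1 + K * τ) * (1 - η) ^ (-(n : ℝ) / 2)) *
            ((4 * Real.pi * (τ / (1 - η))) ^ (-(n : ℝ) / 2) *
              Real.exp (-‖F T w - x₀‖ ^ 2 / (4 * (τ / (1 - η))))) := by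
        intro w
        have hyd : F t w - x₀ = (F T w - x₀) + (F t w - F T w) := by abel
        have hcmp := exp_neg_norm_add_sq_le (F T w - x₀) (F t w - F T w) hτ hη
        rw [← hyd] at hcmp
        have hexpd : Real.exp ((1 / η - 1) * ‖F t w - F T w‖ ^ 2 / (4 * τ)) ≤
            Real.exp ((1 / η - 1) * C' ^ 2 * τ / 4) := by
          refine Real.exp_le_exp.2 ?_
          have h1 : 0 ≤ 1 / η - 1 := by
            rw [sub_nonneg, le_div_iff₀ hη]; linarith
          calc (1 / η - 1) * ‖F t w - F T w‖ ^ 2 / (4 * τ)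
              ≤ (1 / η - 1) * (C' ^ 2 * τ ^ 2) / (4 * τ) :=
                div_le_div_of_nonneg_right (mul_le_mul_of_nonneg_left (hd2 w) h1) (by positivity)
            _ = (1 / η - 1) * C' ^ 2 * τ / 4 := by
                field_simp
        have hexpy : Real.exp (-((1 - η) * ‖F T w - x₀‖ ^ 2) / (4 * τ)) =
            Real.exp (-‖F T w - x₀‖ ^ 2 / (4 * (τ / (1 - η)))) := by
          congr 1
          field_simp
        have hθw := hθup t htb ht.2.le w
        have hθ0 := (hθpos t htb w).le
        have hc0 : 0 ≤ (4 * Real.pi * τ) ^ (-(n : ℝ) / 2) := Real.rpow_nonneg (by positivity) _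
        calc ((4 * Real.pi * τ) ^ (-(n : ℝ) / 2) * Real.exp (-‖F t w - x₀‖ ^ 2 / (4 * τ))) * θ t w
            ≤ ((4 * Real.pi * τ) ^ (-(n : ℝ) / 2) *
                (Real.exp ((1 / η - 1) * C' ^ 2 * τ / 4) *
                  Real.exp (-‖F T w - x₀‖ ^ 2 / (4 * (τ / (1 - η)))))) * (1 + K * τ) := by
              refine mul_le_mul (mul_le_mul_of_nonneg_left ?_ hc0) hθw hθ0 ?_
              · rw [← hexpy]
                exact hcmp.trans (mul_le_mul_of_nonneg_right hexpd (Real.exp_pos _).le)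
              · positivity
          _ = _ := by rw [hresc1]; ring
      have hlo : ∀ w, (Real.exp (-((1 + 1 / η) * C' ^ 2 * τ) / 4) * (1 + η) ^ (-(n : ℝ) / 2)) *
            ((4 * Real.pi * (τ / (1 + η))) ^ (-(n : ℝ) / 2) *
              Real.exp (-‖F T w - x₀‖ ^ 2 / (4 * (τ / (1 + η))))) ≤
          ((4 * Real.pi * τ) ^ (-(n : ℝ) / 2) *
            Real.exp (-‖F t w - x₀‖ ^ 2 / (4 * τ))) * θ t w := by
        intro w
        have hyd : F t w - x₀ = (F T w - x₀) + (F t w - F T w) := by abel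
        have hcmp := le_exp_neg_norm_add_sq (F T w - x₀) (F t w - F T w) hτ hη
        rw [← hyd] at hcmp
        have hexpd : Real.exp (-((1 + 1 / η) * C' ^ 2 * τ) / 4) ≤
            Real.exp (-((1 + 1 / η) * ‖F t w - F T w‖ ^ 2) / (4 * τ)) := by
          refine Real.exp_le_exp.2 ?_
          have h1 : 0 ≤ 1 + 1 / η := by positivity
          calc -((1 + 1 / η) * C' ^ 2 * τ) / 4 = -((1 + 1 / η) * (C' ^ 2 * τ ^ 2)) / (4 * τ) := by
                field_simp
            _ ≤ -((1 + 1 / η) * ‖F t w - F T w‖ ^ 2) / (4 * τ) :=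
                div_le_div_of_nonneg_right (neg_le_neg (mul_le_mul_of_nonneg_left (hd2 w) h1))
                  (by positivity)
        have hexpy : Real.exp (-((1 + η) * ‖F T w - x₀‖ ^ 2) / (4 * τ)) =
            Real.exp (-‖F T w - x₀‖ ^ 2 / (4 * (τ / (1 + η)))) := by
          congr 1
          field_simp
        have hθw := hθge t htb ht.2.le w
        have hc0 : 0 ≤ (4 * Real.pi * τ) ^ (-(n : ℝ) / 2) := Real.rpow_nonneg (by positivity) _
        calc (Real.exp (-((1 + 1 / η) * C' ^ 2 * τ) / 4) * (1 + η) ^ (-(n : ℝ) / 2)) *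
              ((4 * Real.pi * (τ / (1 + η))) ^ (-(n : ℝ) / 2) *
                Real.exp (-‖F T w - x₀‖ ^ 2 / (4 * (τ / (1 + η)))))
            = ((4 * Real.pi * τ) ^ (-(n : ℝ) / 2) *
                (Real.exp (-((1 + 1 / η) * C' ^ 2 * τ) / 4) *
                  Real.exp (-‖F T w - x₀‖ ^ 2 / (4 * (τ / (1 + η)))))) * 1 := by rw [hresc2]; ring
          _ ≤ ((4 * Real.pi * τ) ^ (-(n : ℝ) / 2) * Real.exp (-‖F t w - x₀‖ ^ 2 / (4 * τ))) * θ t w := by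
              refine mul_le_mul (mul_le_mul_of_nonneg_left ?_ hc0) hθw zero_le_one ?_
              · rw [← hexpy]
                exact (mul_le_mul_of_nonneg_right hexpd (Real.exp_pos _).le).trans hcmp
              · positivity
      -- integrate
      have hint1 : Integrable (fun w ↦ ((4 * Real.pi * τ) ^ (-(n : ℝ) / 2) *
          Real.exp (-‖F t w - x₀‖ ^ 2 / (4 * τ))) * θ t w) μT :=
        integrable_of_continuous (h := (euclideanMetric (EuclideanSpace ℝ (Fin (n + 1)))).inducedRiemannianMetric
          (F T) contMDiff_pullbackBilin_holds (h.isSpacelikeImmersion T hT'))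
          ((continuous_const.mul (hEc t htb τ)).mul (hθcont t htb))
      have hint2 : ∀ s : ℝ, Integrable (fun w ↦ (4 * Real.pi * (τ / s)) ^ (-(n : ℝ) / 2) *
          Real.exp (-‖F T w - x₀‖ ^ 2 / (4 * (τ / s)))) μT := fun s ↦
        integrable_of_continuous (h := (euclideanMetric (EuclideanSpace ℝ (Fin (n + 1)))).inducedRiemannianMetric
          (F T) contMDiff_pullbackBilin_holds (h.isSpacelikeImmersion T hT'))
          (continuous_const.mul (hEc T hT' _))
      constructor
      · calc _ ≤ ∫ w, (Real.exp ((1 / η - 1) * C' ^ 2 * τ / 4) * (1 + K * τ) * (1 - η) ^ (-(n : ℝ) / 2)) *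
              ((4 * Real.pi * (τ / (1 - η))) ^ (-(n : ℝ) / 2) *
                Real.exp (-‖F T w - x₀‖ ^ 2 / (4 * (τ / (1 - η))))) ∂μT :=
              integral_mono hint1 ((hint2 (1 - η)).const_mul _) hup
          _ = _ := integral_const_mul _ _
      · calc _ = ∫ w, (Real.exp (-((1 + 1 / η) * C' ^ 2 * τ) / 4) * (1 + η) ^ (-(n : ℝ) / 2)) *
              ((4 * Real.pi * (τ / (1 + η))) ^ (-(n : ℝ) / 2) *
                Real.exp (-‖F T w - x₀‖ ^ 2 / (4 * (τ / (1 + η))))) ∂μT :=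
              (integral_const_mul _ _).symm
          _ ≤ _ := integral_mono ((hint2 (1 + η)).const_mul _) hint1 hlo
    -- limits as `t ↑ T`
    have hτlim : Tendsto (fun t : ℝ ↦ T - t) (𝓝[<] T) (𝓝[>] 0) := by
      refine tendsto_nhdsWithin_of_tendsto_nhds_of_eventually_within _ ?_ ?_
      · have : Tendsto (fun t : ℝ ↦ T - t) (𝓝 T) (𝓝 (T - T)) :=
          (continuous_const.sub continuous_id).tendsto T
        rw [sub_self] at this
        exact this.mono_left nhdsWithin_le_nhds
      · filter_upwards [self_mem_nhdsWithin] with t ht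
        exact sub_pos.2 (mem_Iio.1 ht)
    have hτlim' : ∀ {s : ℝ}, 0 < s → Tendsto (fun t : ℝ ↦ (T - t) / s) (𝓝[<] T) (𝓝[>] 0) := by
      intro s hs
      refine tendsto_nhdsWithin_of_tendsto_nhds_of_eventually_within _ ?_ ?_
      · have h1 : Tendsto (fun t : ℝ ↦ (T - t) / s) (𝓝 T) (𝓝 ((T - T) / s)) :=
          ((continuous_const.sub continuous_id).div_const s).tendsto T
        rw [sub_self, zero_div] at h1
        exact h1.mono_left nhdsWithin_le_nhds
      · filter_upwards [self_mem_nhdsWithin] with t ht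
        exact div_pos (sub_pos.2 (mem_Iio.1 ht)) hs
    have hJlim : Tendsto (fun t ↦ ENNReal.ofReal (∫ w, ((4 * Real.pi * (T - t)) ^ (-(n : ℝ) / 2) *
        Real.exp (-‖F t w - x₀‖ ^ 2 / (4 * (T - t)))) * θ t w ∂μT)) (𝓝[<] T) (𝓝 Θ) := by
      refine hlim.congr' ?_
      filter_upwards [Ioo_mem_nhdsLT hT.1] with t ht
      exact hJ t ht
    -- upper bound
    have hAlim : Tendsto (fun t : ℝ ↦ (Real.exp ((1 / η - 1) * C' ^ 2 * (T - t) / 4) *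
        (1 + K * (T - t)) * (1 - η) ^ (-(n : ℝ) / 2)) *
        ∫ w, (4 * Real.pi * ((T - t) / (1 - η))) ^ (-(n : ℝ) / 2) *
          Real.exp (-‖F T w - x₀‖ ^ 2 / (4 * ((T - t) / (1 - η)))) ∂μT) (𝓝[<] T)
        (𝓝 ((Real.exp ((1 / η - 1) * C' ^ 2 * 0 / 4) * (1 + K * 0) * (1 - η) ^ (-(n : ℝ) / 2)) * 1)) := by
      refine Tendsto.mul ?_ (hSlim.comp (hτlim' h1η))
      have hc : Continuous fun τ : ℝ ↦ Real.exp ((1 / η - 1) * C' ^ 2 * τ / 4) * (1 + K * τ) *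
          (1 - η) ^ (-(n : ℝ) / 2) := by fun_prop
      have h0 : Tendsto (fun t : ℝ ↦ T - t) (𝓝[<] T) (𝓝 0) := by
        have : Tendsto (fun t : ℝ ↦ T - t) (𝓝 T) (𝓝 (T - T)) :=
          (continuous_const.sub continuous_id).tendsto T
        rw [sub_self] at this
        exact this.mono_left nhdsWithin_le_nhds
      exact (hc.tendsto 0).comp h0
    simp only [mul_zero, zero_div, Real.exp_zero, one_mul, add_zero, mul_one] at hAlim
    have hup : Θ ≤ ENNReal.ofReal ((1 - η) ^ (-(n : ℝ) / 2)) := by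
      refine le_of_tendsto_of_tendsto hJlim ((ENNReal.tendsto_ofReal hAlim)) ?_
      filter_upwards [Ioo_mem_nhdsLT hT.1] with t ht
      exact ENNReal.ofReal_le_ofReal (hbounds t ht).1
    -- lower bound
    have hBlim : Tendsto (fun t : ℝ ↦ (Real.exp (-((1 + 1 / η) * C' ^ 2 * (T - t)) / 4) *
        (1 + η) ^ (-(n : ℝ) / 2)) *
        ∫ w, (4 * Real.pi * ((T - t) / (1 + η))) ^ (-(n : ℝ) / 2) *
          Real.exp (-‖F T w - x₀‖ ^ 2 / (4 * ((T - t) / (1 + η)))) ∂μT) (𝓝[<] T)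
        (𝓝 ((Real.exp (-((1 + 1 / η) * C' ^ 2 * 0) / 4) * (1 + η) ^ (-(n : ℝ) / 2)) * 1)) := by
      refine Tendsto.mul ?_ (hSlim.comp (hτlim' h1η'))
      have hc : Continuous fun τ : ℝ ↦ Real.exp (-((1 + 1 / η) * C' ^ 2 * τ) / 4) *
          (1 + η) ^ (-(n : ℝ) / 2) := by fun_prop
      have h0 : Tendsto (fun t : ℝ ↦ T - t) (𝓝[<] T) (𝓝 0) := by
        have : Tendsto (fun t : ℝ ↦ T - t) (𝓝 T) (𝓝 (T - T)) :=
          (continuous_const.sub continuous_id).tendsto T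
        rw [sub_self] at this
        exact this.mono_left nhdsWithin_le_nhds
      exact (hc.tendsto 0).comp h0
    simp only [mul_zero, neg_zero, zero_div, Real.exp_zero, one_mul, mul_one] at hBlim
    have hlow : ENNReal.ofReal ((1 + η) ^ (-(n : ℝ) / 2)) ≤ Θ := by
      refine le_of_tendsto_of_tendsto ((ENNReal.tendsto_ofReal hBlim)) hJlim ?_
      filter_upwards [Ioo_mem_nhdsLT hT.1] with t ht
      exact ENNReal.ofReal_le_ofReal (hbounds t ht).2
    exact ⟨hlow, hup⟩
  -- ### `η → 0`
  have hη0 : Tendsto (fun η : ℝ ↦ ENNReal.ofReal ((1 - η) ^ (-(n : ℝ) / 2))) (𝓝[>] 0) (𝓝 1) := by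
    have h1 : Tendsto (fun η : ℝ ↦ (1 - η) ^ (-(n : ℝ) / 2)) (𝓝 0) (𝓝 ((1 - 0) ^ (-(n : ℝ) / 2))) :=
      ((continuous_const.sub continuous_id).tendsto 0).rpow_const (Or.inl (by norm_num))
    rw [sub_zero, Real.one_rpow] at h1
    have h2 := ENNReal.tendsto_ofReal h1
    rw [ENNReal.ofReal_one] at h2
    exact h2.mono_left nhdsWithin_le_nhds
  have hη0' : Tendsto (fun η : ℝ ↦ ENNReal.ofReal ((1 + η) ^ (-(n : ℝ) / 2))) (𝓝[>] 0) (𝓝 1) := by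
    have h1 : Tendsto (fun η : ℝ ↦ (1 + η) ^ (-(n : ℝ) / 2)) (𝓝 0) (𝓝 ((1 + 0) ^ (-(n : ℝ) / 2))) :=
      ((continuous_const.add continuous_id).tendsto 0).rpow_const (Or.inl (by norm_num))
    rw [add_zero, Real.one_rpow] at h1
    have h2 := ENNReal.tendsto_ofReal h1
    rw [ENNReal.ofReal_one] at h2
    exact h2.mono_left nhdsWithin_le_nhds
  have hev : ∀ᶠ η in 𝓝[>] (0 : ℝ), 0 < η ∧ η < 1 := by
    filter_upwards [Ioo_mem_nhdsGT (zero_lt_one' ℝ)] with η hη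
    exact hη
  refine le_antisymm (ge_of_tendsto hη0 (hev.mono fun η hη ↦ (hsqueeze η hη.1 hη.2).2))
    (le_of_tendsto hη0' (hev.mono fun η hη ↦ (hsqueeze η hη.1 hη.2).1))

/-- **`F_{x₀,T-t}(M_t) → 1` as `t ↑ T` at every point `x₀ = F_T(w₀)` of a smooth slice.**
[cite: Huisken1990, Thm. 3.1] [cite: ColdingMinicozzi2012, Lemma 7.2 (3)] -/
theorem IsClassicalMCF.tendsto_gaussianArea_image_regular
    (h : IsClassicalMCF (euclideanMetric (EuclideanSpace ℝ (Fin (n + 1)))) F ν a b) {T : ℝ}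
    (hT : T ∈ Ioc a b) (w₀ : N) :
    Tendsto (fun t ↦ gaussianArea n (F T w₀) (T - t) (F t '' univ)) (𝓝[<] T) (𝓝 1) := by
  have hlim := h.tendsto_gaussianArea_image (F T w₀) hT
  rwa [h.gaussianDensity_eq_one hT w₀] at hlim


/-- **Off the slice the Gaussian density vanishes**: for `T ∈ (a, b]` and `x₀ ∉ M_T = F_T(N)`,
`Θ(x₀, T) = lim_{t↑T} F_{x₀,T-t}(M_t) = 0` (upper comparison with `F_{x₀,τ'}(M_T) → 0`,
Colding–Minicozzi's Lemma 7.2 (3) off `Σ`, `tendsto_gaussianArea_range_of_notMem`).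
[cite: ColdingMinicozzi2012, Lemma 7.2 (3)] [cite: Huisken1990, Thm. 3.1] -/
theorem IsClassicalMCF.gaussianDensity_eq_zero_of_notMem
    (h : IsClassicalMCF (euclideanMetric (EuclideanSpace ℝ (Fin (n + 1)))) F ν a b) {T : ℝ}
    (hT : T ∈ Ioc a b) {x₀ : EuclideanSpace ℝ (Fin (n + 1))} (hx : x₀ ∉ range (F T)) (w₀ : N) :
    sInf ((fun t ↦ gaussianArea n x₀ (T - t) (F t '' univ)) '' Ioo a T) = 0 := by
  obtain ⟨U, hU, hIU, hF⟩ := h.contMDiffOn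
  have hT' : T ∈ Icc a b := ⟨hT.1.le, hT.2⟩
  -- ### the limit `Θ`
  set Θ := sInf ((fun t ↦ gaussianArea n x₀ (T - t) (F t '' univ)) '' Ioo a T) with hΘ
  have hlim : Tendsto (fun t ↦ gaussianArea n x₀ (T - t) (F t '' univ)) (𝓝[<] T) (𝓝 Θ) :=
    h.tendsto_gaussianArea_image x₀ hT
  -- ### velocity bound and displacement
  have hK : IsCompact (Icc a b ×ˢ (univ : Set N)) := isCompact_Icc.prod isCompact_univ
  obtain ⟨C', hC'⟩ := hK.exists_bound_of_continuousOn
    ((continuousOn_timeDeriv hU hF).mono (Set.prod_mono hIU subset_rfl))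
  have hC'0 : 0 ≤ C' := (norm_nonneg _).trans (hC' (T, w₀) ⟨hT', mem_univ _⟩)
  have hvel : ∀ t ∈ Icc a b, ∀ w, ‖deriv (fun s ↦ F s w) t‖ ≤ C' := fun t ht w ↦
    hC' (t, w) ⟨ht, mem_univ _⟩
  have hdisp : ∀ t ∈ Icc a b, ∀ w, ‖F t w - F T w‖ ≤ C' * (T - t) ∨ T < t := by
    intro t ht w
    by_cases htT : t ≤ T
    · left
      have hmv := (convex_Icc a b).norm_image_sub_le_of_norm_hasDerivWithin_le
        (f := fun s ↦ F s w) (fun s hs ↦ (hasDerivAt_slice hU hF (hIU hs) w).hasDerivWithinAt)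
        (fun s hs ↦ hvel s hs w) hT' ht
      rw [Real.norm_eq_abs, abs_of_nonpos (by linarith), neg_sub] at hmv
      exact hmv
    · right; exact not_le.1 htT
  -- ### the densities relative to `μ_T`
  set μT := riemannianMeasure ((euclideanMetric (EuclideanSpace ℝ (Fin (n + 1)))).inducedRiemannianMetric
    (F T) contMDiff_pullbackBilin_holds (h.isSpacelikeImmersion T hT')) with hμT
  haveI : IsFiniteMeasure μT := isFiniteMeasure_riemannianMeasure _
  set g : ∀ t, t ∈ Icc a b → ContMDiffRiemannianMetric (𝓡 n) ∞ (EuclideanSpace ℝ (Fin n))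
      (TangentSpace (𝓡 n) : N → Type _) := fun t ht ↦
    (euclideanMetric (EuclideanSpace ℝ (Fin (n + 1)))).inducedRiemannianMetric (F t)
      contMDiff_pullbackBilin_holds (h.isSpacelikeImmersion t ht) with hg
  set D : ℝ → N → ℝ := fun t w ↦ (Matrix.of fun i j ↦
    (euclideanMetric (EuclideanSpace ℝ (Fin (n + 1)))).inducedBilin (𝓡 n) (F t) w
      ((trivializationAt (EuclideanSpace ℝ (Fin n)) (TangentSpace (𝓡 n)) w).localFrame
        (EuclideanSpace.basisFun (Fin n) ℝ).toBasis i w)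
      ((trivializationAt (EuclideanSpace ℝ (Fin n)) (TangentSpace (𝓡 n)) w).localFrame
        (EuclideanSpace.basisFun (Fin n) ℝ).toBasis j w)).det with hD
  set θ : ℝ → N → ℝ := fun t w ↦ Real.sqrt (D t w) / Real.sqrt (D T w) with hθ
  have hDchart : ∀ t (ht : t ∈ Icc a b) w,
      chartGramMatrix (g t ht) w (extChartAt (𝓡 n) w w) = Matrix.of fun i j ↦
        (euclideanMetric (EuclideanSpace ℝ (Fin (n + 1)))).inducedBilin (𝓡 n) (F t) w
          ((trivializationAt (EuclideanSpace ℝ (Fin n)) (TangentSpace (𝓡 n)) w).localFrame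
            (EuclideanSpace.basisFun (Fin n) ℝ).toBasis i w)
          ((trivializationAt (EuclideanSpace ℝ (Fin n)) (TangentSpace (𝓡 n)) w).localFrame
            (EuclideanSpace.basisFun (Fin n) ℝ).toBasis j w) :=
    fun t ht w ↦ chartGramMatrix_inducedRiemannianMetric_self (h.isSpacelikeImmersion t ht) w
  have hDpos : ∀ t (ht : t ∈ Icc a b) w, 0 < Real.sqrt (D t w) := fun t ht w ↦ by
    have := sqrt_det_chartGramMatrix_pos (g t ht) w (mem_extChartAt_target w)
    rwa [hDchart t ht w] at this
  have hθcan : ∀ t (ht : t ∈ Icc a b), θ t = fun w ↦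
      Real.sqrt (chartGramMatrix (g t ht) w (extChartAt (𝓡 n) w w)).det /
        Real.sqrt (chartGramMatrix (g T hT') w (extChartAt (𝓡 n) w w)).det := fun t ht ↦ by
    funext w
    simp only [hθ, hD, hDchart t ht w, hDchart T hT' w]
  have hθcont : ∀ t (ht : t ∈ Icc a b), Continuous (θ t) := fun t ht ↦ by
    rw [hθcan t ht]
    exact continuous_sqrt_det_chartGramMatrix_div (g t ht) (g T hT')
  have hθpos : ∀ t (ht : t ∈ Icc a b) w, 0 < θ t w := fun t ht w ↦
    div_pos (hDpos t ht w) (hDpos T hT' w)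
  have hθT : ∀ w, θ T w = 1 := fun w ↦ div_self (hDpos T hT' w).ne'
  have hθd : ∀ t (ht : t ∈ Icc a b) w, HasDerivAt (fun s ↦ θ s w)
      (-‖deriv (fun s ↦ F s w) t‖ ^ 2 * θ t w) t := fun t ht w ↦ by
    have hd := (h.hasDerivAt_sqrt_det_gram_localFrame ht w).div_const (Real.sqrt (D T w))
    simp only [hθ]
    refine hd.congr_deriv ?_
    rw [h.norm_deriv_sq_eq ht w]
    simp only [hD]
    ring
  have ha : a ∈ Icc a b := ⟨le_rfl, hT'.1.trans hT'.2⟩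
  obtain ⟨Mθ, hMθ⟩ := (isCompact_univ (X := N)).exists_bound_of_continuousOn (hθcont a ha).continuousOn
  have hθanti : ∀ w, AntitoneOn (fun s ↦ θ s w) (Icc a b) := fun w ↦ by
    refine antitoneOn_of_hasDerivWithinAt_nonpos (convex_Icc a b)
      (f' := fun t ↦ -‖deriv (fun s ↦ F s w) t‖ ^ 2 * θ t w)
      (fun t ht ↦ (hθd t ht w).continuousAt.continuousWithinAt)
      (fun t ht ↦ (hθd t (interior_subset ht) w).hasDerivWithinAt) fun t ht ↦ ?_
    have := hθpos t (interior_subset ht) w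
    nlinarith [sq_nonneg ‖deriv (fun s ↦ F s w) t‖]
  have hθle : ∀ t ∈ Icc a b, ∀ w, θ t w ≤ Mθ := fun t ht w ↦ by
    have h1 : θ t w ≤ θ a w := hθanti w ha ht ht.1
    have h2 : θ a w ≤ Mθ := by
      have := hMθ w (mem_univ w)
      rw [Real.norm_eq_abs] at this
      exact (le_abs_self _).trans this
    exact h1.trans h2
  have hMθ0 : 0 ≤ Mθ := (hθpos a ha w₀).le.trans (hθle a ha w₀)
  -- `1 ≤ θ_t ≤ 1 + K (T - t)` for `t ≤ T`
  set K : ℝ := C' ^ 2 * Mθ with hKdef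
  have hθge : ∀ t ∈ Icc a b, t ≤ T → ∀ w, 1 ≤ θ t w := fun t ht htT w ↦ by
    rw [← hθT w]; exact hθanti w ht hT' htT
  have hθup : ∀ t ∈ Icc a b, t ≤ T → ∀ w, θ t w ≤ 1 + K * (T - t) := fun t ht htT w ↦ by
    have hmv := (convex_Icc a b).norm_image_sub_le_of_norm_hasDerivWithin_le (C := K)
      (f := fun s ↦ θ s w) (fun s hs ↦ (hθd s hs w).hasDerivWithinAt) (fun s hs ↦ ?_) hT' ht
    · rw [Real.norm_eq_abs, Real.norm_eq_abs, abs_of_nonpos (by linarith : t - T ≤ 0), neg_sub, hθT w] at hmv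
      linarith [le_abs_self (θ t w - 1)]
    · rw [Real.norm_eq_abs, abs_mul, abs_neg, abs_of_nonneg (sq_nonneg _), abs_of_nonneg (hθpos s hs w).le]
      exact mul_le_mul (pow_le_pow_left₀ (norm_nonneg _) (hvel s hs w) 2) (hθle s hs w) (hθpos s hs w).le
        (by positivity)
  -- freeze
  clear_value θ D
  -- ### the two integrals
  -- `J t = ∫ ρ_{T-t}(F_t) θ_t dμ_T` (`= F_{x₀,T-t}(M_t)`), `S τ = ∫ ρ_τ(F_T) dμ_T` (`= F_{x₀,τ}(M_T)`)
  have hJ : ∀ t ∈ Ioo a T, gaussianArea n x₀ (T - t) (F t '' univ) =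
      ENNReal.ofReal (∫ w, ((4 * Real.pi * (T - t)) ^ (-(n : ℝ) / 2) *
        Real.exp (-‖F t w - x₀‖ ^ 2 / (4 * (T - t)))) * θ t w ∂μT) := by
    intro t ht
    have htb : t ∈ Icc a b := ⟨ht.1.le, (ht.2.le.trans hT.2)⟩
    have e1 := h.gaussianArea_image_eq htb x₀ (sub_pos.2 ht.2)
    have e := h.gaussianIntegral_eq_integral htb hT' x₀ T
    rw [e1]
    refine congrArg ENNReal.ofReal ?_
    simp only [hθ, hD]
    exact e.symm
  have hS : ∀ {τ : ℝ}, 0 < τ → gaussianArea n x₀ τ (F T '' univ) =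
      ENNReal.ofReal (∫ w, (4 * Real.pi * τ) ^ (-(n : ℝ) / 2) *
        Real.exp (-‖F T w - x₀‖ ^ 2 / (4 * τ)) ∂μT) := fun {τ} hτ ↦
    h.gaussianArea_image_eq hT' x₀ hτ
  have hSnn : ∀ τ : ℝ, 0 < τ → 0 ≤ ∫ w, (4 * Real.pi * τ) ^ (-(n : ℝ) / 2) *
      Real.exp (-‖F T w - x₀‖ ^ 2 / (4 * τ)) ∂μT := fun τ hτ ↦
    integral_nonneg fun w ↦ mul_nonneg (Real.rpow_nonneg (by positivity) _) (Real.exp_pos _).le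
  -- the static limit off the slice: `S τ → 0`
  have hFT : ContMDiff (𝓡 n) 𝓘(ℝ, EuclideanSpace ℝ (Fin (n + 1))) ∞ (F T) :=
    (h.isSpacelikeImmersion T hT').contMDiff
  have hstatic : Tendsto (fun τ : ℝ ↦ gaussianArea n x₀ τ (range (F T))) (𝓝[>] 0) (𝓝 0) :=
    tendsto_gaussianArea_range_of_notMem (I := 𝓡 n) (finrank_euclideanSpace_fin (𝕜 := ℝ) (n := n))
      hFT (by simp) hx
  have hSlim : Tendsto (fun τ : ℝ ↦ ∫ w, (4 * Real.pi * τ) ^ (-(n : ℝ) / 2) *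
      Real.exp (-‖F T w - x₀‖ ^ 2 / (4 * τ)) ∂μT) (𝓝[>] 0) (𝓝 0) := by
    have h1 := (ENNReal.tendsto_toReal ENNReal.zero_ne_top).comp hstatic
    rw [ENNReal.toReal_zero] at h1
    refine h1.congr' ?_
    filter_upwards [self_mem_nhdsWithin] with τ hτ
    rw [mem_Ioi] at hτ
    rw [comp_apply, ← image_univ, hS hτ, ENNReal.toReal_ofReal (hSnn τ hτ)]
  -- ### continuity of the integrands in `w`
  have hFc : ∀ t ∈ Icc a b, Continuous (F t) := fun t ht ↦ (h.isSpacelikeImmersion t ht).contMDiff.continuous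
  have hEc : ∀ t ∈ Icc a b, ∀ τ : ℝ, Continuous fun w ↦ Real.exp (-‖F t w - x₀‖ ^ 2 / (4 * τ)) :=
    fun t ht τ ↦ ((((hFc t ht).sub continuous_const).norm.pow 2).neg.div_const _).rexp
  -- ### the upper comparison for `η = 1/2`
  have hη : (0:ℝ) < 1/2 := by norm_num
  have hη1 : (1:ℝ)/2 < 1 := by norm_num
  have hsq : ∀ η : ℝ, 0 < η → η < 1 → Θ ≤ ENNReal.ofReal 0 := by
    intro η hη hη1
    have h1η : 0 < 1 - η := by linarith
    have h1η' : 0 < 1 + η := by linarith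
    have hbounds : ∀ t ∈ Ioo a T,
        (∫ w, ((4 * Real.pi * (T - t)) ^ (-(n : ℝ) / 2) *
          Real.exp (-‖F t w - x₀‖ ^ 2 / (4 * (T - t)))) * θ t w ∂μT) ≤
          (Real.exp ((1 / η - 1) * C' ^ 2 * (T - t) / 4) * (1 + K * (T - t)) *
            (1 - η) ^ (-(n : ℝ) / 2)) *
          ∫ w, (4 * Real.pi * ((T - t) / (1 - η))) ^ (-(n : ℝ) / 2) *
            Real.exp (-‖F T w - x₀‖ ^ 2 / (4 * ((T - t) / (1 - η)))) ∂μT := by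
      intro t ht
      have hτ : 0 < T - t := sub_pos.2 ht.2
      have htb : t ∈ Icc a b := ⟨ht.1.le, ht.2.le.trans hT.2⟩
      set τ := T - t with hτdef
      have hd : ∀ w, ‖F t w - F T w‖ ≤ C' * τ := fun w ↦
        (hdisp t htb w).resolve_right (not_lt.2 ht.2.le)
      have hd2 : ∀ w, ‖F t w - F T w‖ ^ 2 ≤ C' ^ 2 * τ ^ 2 := fun w ↦ by
        have := hd w
        nlinarith [norm_nonneg (F t w - F T w)]
      have hresc1 := gaussNormalization_rescale n hτ h1η
      have hresc2 := gaussNormalization_rescale n hτ h1η'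
      -- pointwise
      have hup : ∀ w, ((4 * Real.pi * τ) ^ (-(n : ℝ) / 2) *
          Real.exp (-‖F t w - x₀‖ ^ 2 / (4 * τ))) * θ t w ≤
          (Real.exp ((1 / η - 1) * C' ^ 2 * τ / 4) * (1 + K * τ) * (1 - η) ^ (-(n : ℝ) / 2)) *
            ((4 * Real.pi * (τ / (1 - η))) ^ (-(n : ℝ) / 2) *
              Real.exp (-‖F T w - x₀‖ ^ 2 / (4 * (τ / (1 - η))))) := by
        intro w
        have hyd : F t w - x₀ = (F T w - x₀) + (F t w - F T w) := by abel
        have hcmp := exp_neg_norm_add_sq_le (F T w - x₀) (F t w - F T w) hτ hη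
        rw [← hyd] at hcmp
        have hexpd : Real.exp ((1 / η - 1) * ‖F t w - F T w‖ ^ 2 / (4 * τ)) ≤
            Real.exp ((1 / η - 1) * C' ^ 2 * τ / 4) := by
          refine Real.exp_le_exp.2 ?_
          have h1 : 0 ≤ 1 / η - 1 := by
            rw [sub_nonneg, le_div_iff₀ hη]; linarith
          calc (1 / η - 1) * ‖F t w - F T w‖ ^ 2 / (4 * τ)
              ≤ (1 / η - 1) * (C' ^ 2 * τ ^ 2) / (4 * τ) :=
                div_le_div_of_nonneg_right (mul_le_mul_of_nonneg_left (hd2 w) h1) (by positivity)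
            _ = (1 / η - 1) * C' ^ 2 * τ / 4 := by
                field_simp
        have hexpy : Real.exp (-((1 - η) * ‖F T w - x₀‖ ^ 2) / (4 * τ)) =
            Real.exp (-‖F T w - x₀‖ ^ 2 / (4 * (τ / (1 - η)))) := by
          congr 1
          field_simp
        have hθw := hθup t htb ht.2.le w
        have hθ0 := (hθpos t htb w).le
        have hc0 : 0 ≤ (4 * Real.pi * τ) ^ (-(n : ℝ) / 2) := Real.rpow_nonneg (by positivity) _
        calc ((4 * Real.pi * τ) ^ (-(n : ℝ) / 2) * Real.exp (-‖F t w - x₀‖ ^ 2 / (4 * τ))) * θ t w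
            ≤ ((4 * Real.pi * τ) ^ (-(n : ℝ) / 2) *
                (Real.exp ((1 / η - 1) * C' ^ 2 * τ / 4) *
                  Real.exp (-‖F T w - x₀‖ ^ 2 / (4 * (τ / (1 - η)))))) * (1 + K * τ) := by
              refine mul_le_mul (mul_le_mul_of_nonneg_left ?_ hc0) hθw hθ0 ?_
              · rw [← hexpy]
                exact hcmp.trans (mul_le_mul_of_nonneg_right hexpd (Real.exp_pos _).le)
              · positivity
          _ = _ := by rw [hresc1]; ring
      -- integrate
      have hint1 : Integrable (fun w ↦ ((4 * Real.pi * τ) ^ (-(n : ℝ) / 2) *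
          Real.exp (-‖F t w - x₀‖ ^ 2 / (4 * τ))) * θ t w) μT :=
        integrable_of_continuous (h := (euclideanMetric (EuclideanSpace ℝ (Fin (n + 1)))).inducedRiemannianMetric
          (F T) contMDiff_pullbackBilin_holds (h.isSpacelikeImmersion T hT'))
          ((continuous_const.mul (hEc t htb τ)).mul (hθcont t htb))
      have hint2 : ∀ s : ℝ, Integrable (fun w ↦ (4 * Real.pi * (τ / s)) ^ (-(n : ℝ) / 2) *
          Real.exp (-‖F T w - x₀‖ ^ 2 / (4 * (τ / s)))) μT := fun s ↦
        integrable_of_continuous (h := (euclideanMetric (EuclideanSpace ℝ (Fin (n + 1)))).inducedRiemannianMetric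
          (F T) contMDiff_pullbackBilin_holds (h.isSpacelikeImmersion T hT'))
          (continuous_const.mul (hEc T hT' _))
      calc _ ≤ ∫ w, (Real.exp ((1 / η - 1) * C' ^ 2 * τ / 4) * (1 + K * τ) * (1 - η) ^ (-(n : ℝ) / 2)) *
            ((4 * Real.pi * (τ / (1 - η))) ^ (-(n : ℝ) / 2) *
              Real.exp (-‖F T w - x₀‖ ^ 2 / (4 * (τ / (1 - η))))) ∂μT :=
            integral_mono hint1 ((hint2 (1 - η)).const_mul _) hup
        _ = _ := integral_const_mul _ _
    -- limits as `t ↑ T`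
    have hτlim : Tendsto (fun t : ℝ ↦ T - t) (𝓝[<] T) (𝓝[>] 0) := by
      refine tendsto_nhdsWithin_of_tendsto_nhds_of_eventually_within _ ?_ ?_
      · have : Tendsto (fun t : ℝ ↦ T - t) (𝓝 T) (𝓝 (T - T)) :=
          (continuous_const.sub continuous_id).tendsto T
        rw [sub_self] at this
        exact this.mono_left nhdsWithin_le_nhds
      · filter_upwards [self_mem_nhdsWithin] with t ht
        exact sub_pos.2 (mem_Iio.1 ht)
    have hτlim' : ∀ {s : ℝ}, 0 < s → Tendsto (fun t : ℝ ↦ (T - t) / s) (𝓝[<] T) (𝓝[>] 0) := by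
      intro s hs
      refine tendsto_nhdsWithin_of_tendsto_nhds_of_eventually_within _ ?_ ?_
      · have h1 : Tendsto (fun t : ℝ ↦ (T - t) / s) (𝓝 T) (𝓝 ((T - T) / s)) :=
          ((continuous_const.sub continuous_id).div_const s).tendsto T
        rw [sub_self, zero_div] at h1
        exact h1.mono_left nhdsWithin_le_nhds
      · filter_upwards [self_mem_nhdsWithin] with t ht
        exact div_pos (sub_pos.2 (mem_Iio.1 ht)) hs
    have hJlim : Tendsto (fun t ↦ ENNReal.ofReal (∫ w, ((4 * Real.pi * (T - t)) ^ (-(n : ℝ) / 2) *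
        Real.exp (-‖F t w - x₀‖ ^ 2 / (4 * (T - t)))) * θ t w ∂μT)) (𝓝[<] T) (𝓝 Θ) := by
      refine hlim.congr' ?_
      filter_upwards [Ioo_mem_nhdsLT hT.1] with t ht
      exact hJ t ht
    -- upper bound
    have hAlim : Tendsto (fun t : ℝ ↦ (Real.exp ((1 / η - 1) * C' ^ 2 * (T - t) / 4) *
        (1 + K * (T - t)) * (1 - η) ^ (-(n : ℝ) / 2)) *
        ∫ w, (4 * Real.pi * ((T - t) / (1 - η))) ^ (-(n : ℝ) / 2) *
          Real.exp (-‖F T w - x₀‖ ^ 2 / (4 * ((T - t) / (1 - η)))) ∂μT) (𝓝[<] T)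
        (𝓝 ((Real.exp ((1 / η - 1) * C' ^ 2 * 0 / 4) * (1 + K * 0) * (1 - η) ^ (-(n : ℝ) / 2)) * 0)) := by
      refine Tendsto.mul ?_ (hSlim.comp (hτlim' h1η))
      have hc : Continuous fun τ : ℝ ↦ Real.exp ((1 / η - 1) * C' ^ 2 * τ / 4) * (1 + K * τ) *
          (1 - η) ^ (-(n : ℝ) / 2) := by fun_prop
      have h0 : Tendsto (fun t : ℝ ↦ T - t) (𝓝[<] T) (𝓝 0) := by
        have : Tendsto (fun t : ℝ ↦ T - t) (𝓝 T) (𝓝 (T - T)) :=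
          (continuous_const.sub continuous_id).tendsto T
        rw [sub_self] at this
        exact this.mono_left nhdsWithin_le_nhds
      exact (hc.tendsto 0).comp h0
    simp only [zero_div, Real.exp_zero, one_mul, add_zero, mul_zero] at hAlim
    refine le_of_tendsto_of_tendsto hJlim (ENNReal.tendsto_ofReal hAlim) ?_
    filter_upwards [Ioo_mem_nhdsLT hT.1] with t ht
    exact ENNReal.ofReal_le_ofReal (hbounds t ht)
  have hfin := hsq (1/2) hη hη1
  rw [ENNReal.ofReal_zero] at hfin
  exact le_antisymm hfin bot_le

/-- **`F_{x₀,T-t}(M_t) → 0` as `t ↑ T` for `x₀ ∉ M_T`.** [cite: ColdingMinicozzi2012, Lemma 7.2 (3)] -/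
theorem IsClassicalMCF.tendsto_gaussianArea_image_of_notMem
    (h : IsClassicalMCF (euclideanMetric (EuclideanSpace ℝ (Fin (n + 1)))) F ν a b) {T : ℝ}
    (hT : T ∈ Ioc a b) {x₀ : EuclideanSpace ℝ (Fin (n + 1))} (hx : x₀ ∉ range (F T)) (w₀ : N) :
    Tendsto (fun t ↦ gaussianArea n x₀ (T - t) (F t '' univ)) (𝓝[<] T) (𝓝 0) := by
  have hlim := h.tendsto_gaussianArea_image x₀ hT
  rwa [h.gaussianDensity_eq_zero_of_notMem hT hx w₀] at hlim

end RegularPoint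

end Literature.Geometry.Riemannian

end
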